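import Summits.BirchSwinnertonDyer.BirchSwinnertonDyer.Theorems.AlignedTransportAtTwoMainConjectureOfRankZeroBSDAtTwoCubicOffStratumFukudaIndexTools
import HarnessLib

/-!
# Route `AlignedTransportAtTwo`, crux C2 `MainConjectureOfRankZeroBSDAtTwo` (stmt-BirchSwinnertonDyer-22298):
# THE RAMIFICATION TRANSFER — `√2 ∈ L`, `√D ∈ T` (`D ≡ 3 (mod 4)`), `e(w|2) = 2` below, `e ≤ 2` in `T` ⟹ a prime `Q ∋ 2` of `L` with `4 ∣ e(Q|2)`;
# and for a CUBIC field: one such prime in the first layer `K(√2)` ⟹ Fukuda's index is `0` (`TotallyRamifiedFrom κ 0`)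

HONEST FRAMING (cell `bsd-f1-sign2`, WIDTH-5 attached prover seat `bsd-line-att-p5` gen 28 on line `birth` of the lead `bsd-line-att-p2`;
`--supports` stmt-BirchSwinnertonDyer-22298, closes nothing; BSD is NOT proved by any of this; the crux C2, its verdict «blocked-on
`Rank1Residual.GreenbergMuConjectureIrreducible`» and every registered stub are untouched). THEOREMS ONLY — no definition, no named fact,
no `sorry`; pure number-field statements (no elliptic curve appears in this file). Sequel of `…CubicOffStratumFukudaIndexTools` (att-p5 g28: the
element certificate `4 ∣ e(𝔔|2)`, the inertia product inequality, the `𝓞`-transport); consumed by `…CubicOffStratumFukudaIndex` (the seed cell).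

* §3 **`exists_four_dvd_ramificationIdx_of_sq_eq_two_of_sq_eq_intCast`**: `F` a number field, `E ⊇ F` any field, `L, T ⊆ E` intermediate fields finite
  Galois over `F` with `θ ∈ L` (`θ² = 2`) and `δ ∈ T` (`δ² = D ≡ 3 (mod 4)`); if `F` has a prime `w ∋ 2` with `e(w|2) = 2` and every prime of `T` above `2`
  has `e ≤ 2`, then `L` has a prime `Q ∋ 2` with `4 ∣ e(Q|2)`. In the compositum `M = L ⊔ T` (Galois over `F`, Mathlib `IntermediateField.normal_sup`):
  for `𝔔 ∣ w`, `4 ∣ e(𝔔|2) = 2·e(𝔔|w) = e(𝔔∩T|2)·e(𝔔|𝔔∩T)` with `e(𝔔∩T|2) = 2` (even, `≤ 2`), so `e(𝔔|𝔔∩T) = e(𝔔|w)` and the product inequality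
  forces `e(𝔔|𝔔∩L) = 1`, i.e. `e(𝔔∩L|2) = e(𝔔|2)`.
* §4 **`totallyRamifiedFrom_zero_of_exists_four_dvd_ramificationIdx`**: for a CUBIC field `K` and a cyclotomic `ℤ₂`-extension `κ`, ONE prime `Q ∋ 2` of
  `K₁ = κ.layer 1` with `4 ∣ e(Q|2)` gives `TotallyRamifiedFrom κ 0` — the tail of bsd-2adic's `totallyRamifiedFrom_zero_of_evenIndexCertificate` detached
  from its certificate (`ramificationIdx_eq_two_of_four_dvd`, parity for the odd-index primes, the first-layer criterion).

References: [NeukirchANT1999] Ch. I §8 Prop. (8.2), §9 Prop. (9.4), (9.6); [Washington1997] §13.1 Prop. 13.2, Lemma 13.3 (proof); [Fukuda1994] p. 264 (the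
index `n₀`).
-/

set_option linter.dupNamespace false
set_option autoImplicit false

noncomputable section

open scoped NumberField
open NumberField IsDedekindDomain

namespace Summit.BirchSwinnertonDyer.BirchSwinnertonDyer.Theorems.AlignedTransportAtTwoCubicOffStratumFukudaIndexTransfer

open Summit.BirchSwinnertonDyer.BirchSwinnertonDyer.Theorems.AlignedTransportAtTwoCubicOffStratumFukudaIndexTools

/-! ## §3 Assembly inside an ambient field: `4 ∣ e(Q|2)` for some prime `Q` of `L` -/

section Assembly

variable {F E : Type*} [Field F] [NumberField F] [Field E] [Algebra F E]

/-- **THE RAMIFICATION TRANSFER.** Let `F` be a number field, `E ⊇ F` any field, `L, T ⊆ E` intermediate fields finite and Galois over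
`F`, with `θ ∈ L`, `θ² = 2`, and `δ ∈ T`, `δ² = D`, `D ≡ 3 (mod 4)`. Suppose `F` has a prime `w ∋ 2` with `e(w|2) = 2` and every prime
of `T` above `2` has `e ≤ 2`. Then `L` has a prime `Q ∋ 2` with `4 ∣ e(Q|2)`. Proof in `M = L·T` (Galois over `F`): for `𝔔 ∣ w`,
`4 ∣ e(𝔔|2)` (§1), `e(𝔔|2) = 2·e(𝔔|w) = e(𝔔∩T|2)·e(𝔔|𝔔∩T)` with `e(𝔔∩T|2) = 2` (even and `≤ 2`), so `e(𝔔|𝔔∩T) = e(𝔔|w)`; the product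
inequality (§2) gives `e(𝔔|𝔔∩L) = 1`, hence `e(𝔔∩L|2) = e(𝔔|2)`. (Locally: `F_w = ℚ₂(√D)` and `√2 ∉ ℚ₂(√D)(unram)`: the prime `w` ramifies
again in `L`.) [cite: NeukirchANT1999, Ch. I §8 Prop. (8.2), §9 Prop. (9.4), (9.6)] [cite: Washington1997, §13.1] -/
theorem exists_four_dvd_ramificationIdx_of_sq_eq_two_of_sq_eq_intCast (L T : IntermediateField F E)
    [FiniteDimensional F L] [FiniteDimensional F T] [IsGalois F L] [IsGalois F T]
    {θ δ : E} (hθL : θ ∈ L) (hδT : δ ∈ T) (hθ : θ ^ 2 = 2) {D : ℤ} (hδ : δ ^ 2 = (D : E)) (hD : D % 4 = 3)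
    (w : Ideal (𝓞 F)) [w.IsPrime] (hw2 : (2 : 𝓞 F) ∈ w) (hwe : w.ramificationIdx ℤ = 2)
    (hT : ∀ P : Ideal (𝓞 T), P.IsPrime → (2 : 𝓞 T) ∈ P → P.ramificationIdx ℤ ≤ 2) :
    ∃ Q : Ideal (𝓞 L), Q.IsPrime ∧ (2 : 𝓞 L) ∈ Q ∧ 4 ∣ Q.ramificationIdx ℤ := by
  classical
  -- the compositum `M = L ⊔ T`, Galois over `F`
  haveI : FiniteDimensional F ↥(L ⊔ T) := IntermediateField.finiteDimensional_sup L T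
  haveI : Normal F ↥(L ⊔ T) := inferInstance
  haveI : IsGalois F ↥(L ⊔ T) := ⟨⟩
  set M : IntermediateField F E := L ⊔ T with hMdef
  haveI : NumberField L := NumberField.of_module_finite F L
  haveI : NumberField T := NumberField.of_module_finite F T
  haveI : NumberField M := NumberField.of_module_finite F M
  -- the inclusions `L, T ⊆ M`
  letI algL : Algebra L M := (IntermediateField.inclusion (le_sup_left : L ≤ M)).toRingHom.toAlgebra
  letI algT : Algebra T M := (IntermediateField.inclusion (le_sup_right : T ≤ M)).toRingHom.toAlgebra
  haveI : IsScalarTower F L M := IsScalarTower.of_algebraMap_eq fun x => rfl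
  haveI : IsScalarTower F T M := IsScalarTower.of_algebraMap_eq fun x => rfl
  haveI : Module.Finite (𝓞 F) (𝓞 M) := IsIntegralClosure.finite (𝓞 F) F M (𝓞 M)
  haveI : Module.Finite (𝓞 L) (𝓞 M) := IsIntegralClosure.finite (𝓞 L) L M (𝓞 M)
  haveI : Module.Finite (𝓞 T) (𝓞 M) := IsIntegralClosure.finite (𝓞 T) T M (𝓞 M)
  -- generation: an `F`-automorphism of `M` fixing `L` and `T` is trivial
  have hgen : ∀ σ : M ≃ₐ[F] M, (∀ x : L, σ (algebraMap L M x) = algebraMap L M x) →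
      (∀ y : T, σ (algebraMap T M y) = algebraMap T M y) → σ = 1 := by
    intro σ hσL hσT
    set Lr : IntermediateField F M := IntermediateField.restrict (le_sup_left : L ≤ M) with hLr
    set Tr : IntermediateField F M := IntermediateField.restrict (le_sup_right : T ≤ M) with hTr
    have hsup : Lr ⊔ Tr = ⊤ := by
      apply IntermediateField.lift_injective M
      rw [IntermediateField.lift_sup, IntermediateField.lift_top, hLr, hTr, IntermediateField.lift_restrict,
        IntermediateField.lift_restrict]
    have hσLr : σ ∈ Lr.fixingSubgroup := by
      rw [IntermediateField.mem_fixingSubgroup_iff]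
      intro x hx
      rw [hLr, IntermediateField.mem_restrict] at hx
      exact hσL ⟨x.1, hx⟩
    have hσTr : σ ∈ Tr.fixingSubgroup := by
      rw [IntermediateField.mem_fixingSubgroup_iff]
      intro x hx
      rw [hTr, IntermediateField.mem_restrict] at hx
      exact hσT ⟨x.1, hx⟩
    have hmem : σ ∈ (Lr ⊔ Tr).fixingSubgroup := by
      rw [IntermediateField.fixingSubgroup_sup]; exact ⟨hσLr, hσTr⟩
    rw [hsup, IntermediateField.fixingSubgroup_top, Subgroup.mem_bot] at hmem
    exact hmem
  -- a prime `𝔔` of `M` over `w`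
  have hw0 : w ≠ ⊥ := fun h => by rw [h, Ideal.mem_bot] at hw2; exact two_ne_zero hw2
  haveI : w.IsMaximal := Ideal.IsPrime.isMaximal inferInstance hw0
  obtain ⟨⟨𝔔, h𝔔prime, h𝔔over⟩⟩ := (inferInstance : Nonempty (Ideal.primesOver w (𝓞 M)))
  haveI := h𝔔prime
  haveI := h𝔔over
  have h2𝔔 : (2 : 𝓞 M) ∈ 𝔔 := by
    have := (Ideal.mem_of_liesOver 𝔔 w (2 : 𝓞 F)).mp hw2
    rwa [map_ofNat] at this
  haveI h𝔔2 : 𝔔.LiesOver (Ideal.span {(2 : ℤ)}) := by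
    rw [Ideal.liesOver_span_iff h𝔔prime.ne_top Int.prime_two, map_ofNat]; exact h2𝔔
  haveI hw2' : w.LiesOver (Ideal.span {(2 : ℤ)}) := by
    rw [Ideal.liesOver_span_iff Ideal.IsPrime.ne_top' Int.prime_two, map_ofNat]; exact hw2
  -- the primes below `𝔔` in `L` and `T`
  set Q : Ideal (𝓞 L) := 𝔔.under (𝓞 L) with hQ
  set P : Ideal (𝓞 T) := 𝔔.under (𝓞 T) with hP
  haveI : 𝔔.LiesOver Q := ⟨rfl⟩
  haveI : 𝔔.LiesOver P := ⟨rfl⟩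
  have h2Q : (2 : 𝓞 L) ∈ Q := by rw [hQ, Ideal.under_def, Ideal.mem_comap, map_ofNat]; exact h2𝔔
  have h2P : (2 : 𝓞 T) ∈ P := by rw [hP, Ideal.under_def, Ideal.mem_comap, map_ofNat]; exact h2𝔔
  haveI hQ2 : Q.LiesOver (Ideal.span {(2 : ℤ)}) := by
    rw [Ideal.liesOver_span_iff Ideal.IsPrime.ne_top' Int.prime_two, map_ofNat]; exact h2Q
  haveI hP2 : P.LiesOver (Ideal.span {(2 : ℤ)}) := by
    rw [Ideal.liesOver_span_iff Ideal.IsPrime.ne_top' Int.prime_two, map_ofNat]; exact h2P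
  -- `4 ∣ e(𝔔|2)` : `θ, δ ∈ M`
  have hθM : θ ∈ M := (le_sup_left : L ≤ M) hθL
  have hδM : δ ∈ M := (le_sup_right : T ≤ M) hδT
  have h4 : 4 ∣ 𝔔.ramificationIdx ℤ := by
    have hθ' : (⟨θ, hθM⟩ : M) ^ 2 = 2 := Subtype.ext hθ
    have hδ' : (⟨δ, hδM⟩ : M) ^ 2 = ((D : M)) := Subtype.ext (by push_cast; exact hδ)
    exact four_dvd_ramificationIdx_of_sq_eq_two_of_sq_eq_intCast hθ' hδ' hD 𝔔 h2𝔔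
  -- `e(P|2) = 2`
  have hPe : P.ramificationIdx ℤ = 2 := by
    have hle := hT P inferInstance h2P
    have hδ' : (⟨δ, hδT⟩ : T) ^ 2 = ((D : T)) := Subtype.ext (by push_cast; exact hδ)
    have hev := even_ramificationIdx_of_sq_eq_intCast_of_emod_four_eq_three hδ' hD P h2P
    have hpos : 0 < P.ramificationIdx ℤ := Ideal.ramificationIdx_pos P ℤ
    obtain ⟨k, hk⟩ := hev
    omega
  -- towers: `e(𝔔|2) = e(w|2) e(𝔔|w) = e(P|2) e(𝔔|P) = e(Q|2) e(𝔔|Q)`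
  have htF : 𝔔.ramificationIdx ℤ = w.ramificationIdx ℤ * 𝔔.ramificationIdx (𝓞 F) := Ideal.ramificationIdx_tower w 𝔔
  have htT : 𝔔.ramificationIdx ℤ = P.ramificationIdx ℤ * 𝔔.ramificationIdx (𝓞 T) := Ideal.ramificationIdx_tower P 𝔔
  have htL : 𝔔.ramificationIdx ℤ = Q.ramificationIdx ℤ * 𝔔.ramificationIdx (𝓞 L) := Ideal.ramificationIdx_tower Q 𝔔
  rw [hwe] at htF
  rw [hPe] at htT
  -- product inequality
  have hprod := ramificationIdx_mul_ramificationIdx_le_of_generate (F := F) (L := L) (T := T) (M := M) hgen 𝔔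
  have haL : 0 < 𝔔.ramificationIdx (𝓞 L) := Ideal.ramificationIdx_pos 𝔔 (𝓞 L)
  have hbT : 0 < 𝔔.ramificationIdx (𝓞 T) := Ideal.ramificationIdx_pos 𝔔 (𝓞 T)
  have hTF : 𝔔.ramificationIdx (𝓞 T) = 𝔔.ramificationIdx (𝓞 F) := by omega
  have ha1 : 𝔔.ramificationIdx (𝓞 L) = 1 := by
    rw [hTF] at hprod
    have hcF : 0 < 𝔔.ramificationIdx (𝓞 F) := by omega
    nlinarith
  refine ⟨Q, inferInstance, h2Q, ?_⟩
  rw [ha1, mul_one] at htL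
  rw [← htL]; exact h4

end Assembly

open Literature.NumberTheory.IwasawaTheory Literature.NumberTheory.EllipticCurves
  Literature.NumberTheory.GaloisRepresentations Field

/-! ## §4 Cubic fields: one prime of the first layer with `4 ∣ e` gives Fukuda's index `0` -/

section Cubic

variable {K : Type} [Field K] [NumberField K]

/-- **Fukuda's index is `0` for a cubic field as soon as ONE prime `Q ∋ 2` of the first layer `K₁ = K(√2)` has `4 ∣ e(Q|2)`.**
For a cubic number field `K` and a cyclotomic `ℤ₂`-extension `κ` of `K`: such a `Q` lies over a prime `w` of `K` with `e(w|2) = 2` and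
`e(Q|w) = 2` (tree `ramificationIdx_eq_two_of_four_dvd`); `w` is then the ONLY prime of `K` above `2` with even index (`Σ eᵢfᵢ = 3`), so
every prime of `K` above `2` is ramified in `K₁` — the odd-index ones by parity (tree `not_isUnramifiedIn_layer_one_of_odd_ramificationIdx`)
— and the first-layer criterion (tree `totallyRamifiedFrom_zero_of_forall_not_isUnramifiedIn_layer_one`) concludes. This is the tail of
the tree's `totallyRamifiedFrom_zero_of_evenIndexCertificate`, detached from its certificate. [cite: Washington1997, §13.1 Lemma 13.3 (proof)]
[cite: Fukuda1994, p. 264 (the index `n₀`)] [cite: NeukirchANT1999, Ch. I §8, Prop. (8.2)] -/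
theorem totallyRamifiedFrom_zero_of_exists_four_dvd_ramificationIdx (hK : Module.finrank ℚ K = 3)
    (κ : ZpExtension K 2) (hκ : κ.IsCyclotomic)
    (hQ : haveI : FiniteDimensional K (κ.layer 1) := κ.finiteDimensional_layer_holds 1
      haveI : NumberField (κ.layer 1) := NumberField.of_module_finite K _
      ∃ Q : Ideal (𝓞 (κ.layer 1)), Q.IsPrime ∧ (2 : 𝓞 (κ.layer 1)) ∈ Q ∧ 4 ∣ Q.ramificationIdx ℤ) :
    TotallyRamifiedFrom κ 0 := by
  classical
  haveI : FiniteDimensional K (κ.layer 1) := κ.finiteDimensional_layer_holds 1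
  haveI : NumberField (κ.layer 1) := NumberField.of_module_finite K _
  haveI : IsScalarTower ℤ (𝓞 K) (κ.layer 1) := IsScalarTower.of_algebraMap_eq fun n => by simp
  have hK2 : ¬ 2 ∣ Module.finrank ℚ K := by rw [hK]; norm_num
  obtain ⟨Q, hQprime, h2Q, h4⟩ := hQ
  haveI := hQprime
  obtain ⟨hw₀, hQw₀⟩ := ramificationIdx_eq_two_of_four_dvd hK κ Q h2Q h4
  haveI : (Ideal.span {(2 : ℤ)}).IsMaximal :=
    Ideal.IsPrime.isMaximal ((Ideal.span_singleton_prime two_ne_zero).mpr Int.prime_two) (by simp)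
  have h20 : (Ideal.span {(2 : ℤ)} : Ideal ℤ) ≠ ⊥ := by simp
  refine totallyRamifiedFrom_zero_of_forall_not_isUnramifiedIn_layer_one κ fun w hw2 hunr => ?_
  rcases Nat.even_or_odd (w.asIdeal.ramificationIdx ℤ) with heven | hodd
  · -- `w` has even index: it is the prime below `Q`
    haveI : w.asIdeal.IsPrime := w.isPrime
    have hw2' : (2 : 𝓞 K) ∈ w.asIdeal := by exact_mod_cast hw2
    haveI hwl : w.asIdeal.LiesOver (Ideal.span {(2 : ℤ)}) := by
      rw [Ideal.liesOver_span_iff w.isPrime.ne_top Int.prime_two, map_ofNat]; exact hw2'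
    have hu2 : (2 : 𝓞 K) ∈ Q.under (𝓞 K) := by
      rw [Ideal.under_def, Ideal.mem_comap, map_ofNat]; exact h2Q
    haveI hul : (Q.under (𝓞 K)).LiesOver (Ideal.span {(2 : ℤ)}) := by
      rw [Ideal.liesOver_span_iff Ideal.IsPrime.ne_top' Int.prime_two, map_ofNat]; exact hu2
    have heq : w.asIdeal = Q.under (𝓞 K) := by
      by_contra hne
      have hsum := Ideal.sum_ramification_inertia (R := ℤ) (𝓞 K) ℚ K (p := Ideal.span {(2 : ℤ)}) h20
      rw [hK] at hsum
      have hmemw : w.asIdeal ∈ IsDedekindDomain.primesOverFinset (Ideal.span {(2 : ℤ)}) (𝓞 K) :=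
        (IsDedekindDomain.mem_primesOverFinset_iff h20 _).mpr ⟨w.isPrime, hwl⟩
      have hmemu : Q.under (𝓞 K) ∈ IsDedekindDomain.primesOverFinset (Ideal.span {(2 : ℤ)}) (𝓞 K) :=
        (IsDedekindDomain.mem_primesOverFinset_iff h20 _).mpr ⟨inferInstance, hul⟩
      have hsub : ({w.asIdeal, Q.under (𝓞 K)} : Finset (Ideal (𝓞 K))) ⊆
          IsDedekindDomain.primesOverFinset (Ideal.span {(2 : ℤ)}) (𝓞 K) := by
        intro P hP
        rcases Finset.mem_insert.mp hP with rfl | hP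
        · exact hmemw
        · rw [Finset.mem_singleton.mp hP]; exact hmemu
      have hle := Finset.sum_le_sum_of_subset (f := fun P =>
        Ideal.ramificationIdx' (Ideal.span {(2 : ℤ)}) P * Ideal.inertiaDeg' (Ideal.span {(2 : ℤ)}) P) hsub
      rw [Finset.sum_pair hne, hsum] at hle
      have hew : Ideal.ramificationIdx' (Ideal.span {(2 : ℤ)}) w.asIdeal = w.asIdeal.ramificationIdx ℤ :=
        Ideal.ramificationIdx'_eq_ramificationIdx _ _ h20
      have heu : Ideal.ramificationIdx' (Ideal.span {(2 : ℤ)}) (Q.under (𝓞 K)) = 2 := by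
        rw [Ideal.ramificationIdx'_eq_ramificationIdx _ _ h20, hw₀]
      have hfw := Ideal.inertiaDeg'_pos (Ideal.span {(2 : ℤ)}) w.asIdeal
      have hfu := Ideal.inertiaDeg'_pos (Ideal.span {(2 : ℤ)}) (Q.under (𝓞 K))
      have hewpos : 0 < w.asIdeal.ramificationIdx ℤ := Ideal.ramificationIdx_pos _ ℤ
      obtain ⟨k, hk⟩ := heven
      simp only [hew, heu] at hle
      have hk1 : 1 ≤ k := by omega
      nlinarith
    haveI : Q.LiesOver w.asIdeal := by rw [heq]; exact ⟨rfl⟩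
    have h1 := hunr.ramificationIdx_eq_one (𝔓 := Q) ‹_›
    omega
  · exact not_isUnramifiedIn_layer_one_of_odd_ramificationIdx hK2 κ hκ hw2 hodd hunr

end Cubic

end Summit.BirchSwinnertonDyer.BirchSwinnertonDyer.Theorems.AlignedTransportAtTwoCubicOffStratumFukudaIndexTransfer

end
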